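import Summits.HodgeConjecture.HodgeConjecture.Theorems.F0P3SmoothInvariantFormRigidity   -- ★ HB4: `form_apply_avg_left/right`, `avg`
import Mathlib.Analysis.InnerProductSpace.Projection.Basic
import HarnessLib

/-!
# Crux `H413` — rung 4, ED. 4, row «RC» (K4), generic half: in an ADMISSIBLE smooth representation with an invariant inner product every
# sub-representation has an invariant orthogonal complement, and the cyclic span of a spherical Hecke line is IRREDUCIBLE
# (Bernstein–Zelevinsky 1976 §2.3; Bump 1997 §4.2 Prop. 4.2.3; Casselman 1995 §2.1)

Floor-0 programme P3 «U3-mult», seat B-p08 (g20); crux item stmt-HodgeConjecture-24833 (`HCCMUnconditional.H413`); F0P3-plan (g5) RULING (V33)(4) row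
«RC» (`Theorems/F0P3RamClsOfRecord.lean`, the finiteness of the non-sphericity set `ramCls₀ P` of a hol-cotangent discrete `P`).  PROOF lane
(`--supports stmt-HodgeConjecture-24833 --as helper`): theorems only, no `def`, no named fact, no instance, no notation, no `sorry`.  GENERIC — no automorphic
object occurs in this file.  HONEST LABEL: HC_CM is proved only modulo the printed citations until rung 0 closes; this file discharges none of them.

THE POINT.  «RC» needs, at almost every finite place `v`, an ADMISSIBLE, UNITARIZABLE, `K_v`-SPHERICAL irreducible constituent of the restriction of a
hol-cotangent `P` to `U(H)(L⁺_v)`.  Admissibility is in-house along the Matsushima line (★ `F0P3FinComponentAdmissible`); sphericity comes from a common Hecke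
eigenvector (★ `HeckeCommonEigenvector`, Gelfand pair ★ `HyperspecialGelfandPair_holds`); the missing generic input is that the cyclic span of such an
eigenvector is ALREADY IRREDUCIBLE (then it is a SUB-representation of the unitary `P`, unitarizable by restriction — no quotient, no `HasFinComponent`).
This is the semisimplicity of admissible unitary representations, proved here in the pre-Hilbert (not complete) setting the smooth vectors live in:

* §1 `apply_mem_orthogonal` — for `ρ` preserving the inner product, `Nᗮ` is `ρ`-stable; `avg_mem` — the averaging projector `e_H` (★ `SmoothProjector.avg`)
  preserves every sub-representation; `isUnitarizable_of_inner_map_map` — the inner product is an invariant positive-definite Hermitian form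
  (★ `Representation.IsUnitarizable`).
* §2 **`exists_mem_add_mem_orthogonal`** — `ρ` ADMISSIBLE and inner-product preserving, `G` with a compact open subgroup: `V = N + Nᗮ` for every
  sub-representation `N`.  Proof: for `v ∈ V` choose the compact open `K′ = K₀ ∩ Stab(v)`; `V^{K′}` is finite-dimensional, so `M := N ∩ V^{K′}` has an
  orthogonal projection (Mathlib `Submodule.starProjection`); `v = P_M v + (v − P_M v)` and `v − P_M v ⟂ N`, because for `x ∈ N`,
  `⟪x, v − P_M v⟫ = ⟪e_{K′} x, v − P_M v⟫` (★ HB4 `form_apply_avg_left`: `v − P_M v` is `K′`-fixed) with `e_{K′} x ∈ M`.  `sup_orthogonal_eq_top`,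
  `isCompl_orthogonal`.
* §3 **`isIrreducible_of_cyclic_spherical_line`** — if moreover `e ≠ 0` is `K`-fixed, its translates SPAN `V`, and `V^K ⊆ ℂe` (★ Bump's coset-sum step
  `exists_eq_smul_of_mem_span_of_heckeEigenvector` supplies this for a Hecke eigenvector), then `ρ` is IRREDUCIBLE: a sub-representation `N` splits
  `e = u + u′` along `V = N ⊕ Nᗮ` with `u, u′` again `K`-fixed (uniqueness of the decomposition), so `u ∈ ℂe`; `u ≠ 0` forces `e ∈ N`, `N = ⊤`, and
  `u = 0` forces `e ∈ Nᗮ`, `N = ⊥`.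

References: Bernstein–Zelevinsky (1976) §2.3 [BernsteinZelevinsky1976]; Bump (1997) §4.2, Prop. 4.2.3 [Bump1997]; Casselman (1995) §2.1 [Casselman1995];
Bushnell–Henniart (2006) §2, §11.1 [BushnellHenniart2006].
-/

set_option autoImplicit false
-- the mandated namespace repeats `HodgeConjecture.HodgeConjecture`, as in every `Theorems/*.lean` of this sub-problem
set_option linter.dupNamespace false

noncomputable section

open scoped InnerProductSpace ComplexConjugate
open Literature.NumberTheory.Automorphic.SmoothProjector
open Summit.HodgeConjecture.HodgeConjecture.Cruxes.H413.F0P3SmoothInvariantFormRigidity (form_apply_avg_left)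

namespace Summit.HodgeConjecture.HodgeConjecture.Cruxes.H413.F0P3AdmissibleUnitaryComplement

variable {G : Type*} [Group G] [TopologicalSpace G] [IsTopologicalGroup G]
  {V : Type*} [NormedAddCommGroup V] [InnerProductSpace ℂ V] {ρ : Representation ℂ G V}

/-! ## §1 Stability of orthogonal complements; the averaging projector preserves sub-representations -/

omit [TopologicalSpace G] [IsTopologicalGroup G] in
/-- **`Nᗮ` is `ρ`-stable** when `ρ` preserves the inner product (`⟪u, ρ g v⟫ = ⟪ρ g⁻¹ u, v⟫ = 0`). [cite: BushnellHenniart2006, §11.1] -/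
theorem apply_mem_orthogonal (hU : ∀ (g : G) (x y : V), ⟪ρ g x, ρ g y⟫_ℂ = ⟪x, y⟫_ℂ) (N : Subrepresentation ρ) (g : G) {v : V}
    (hv : v ∈ N.toSubmoduleᗮ) : ρ g v ∈ N.toSubmoduleᗮ := by
  rw [Submodule.mem_orthogonal] at hv ⊢
  intro u hu
  have h := hv (ρ g⁻¹ u) (N.apply_mem_toSubmodule g⁻¹ hu)
  rwa [← hU g, ← Module.End.mul_apply, ← map_mul, mul_inv_cancel, map_one, Module.End.one_apply] at h

omit [TopologicalSpace G] [IsTopologicalGroup G] [NormedAddCommGroup V] [InnerProductSpace ℂ V] in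
/-- **The averaging projector preserves sub-representations**: `e_H x ∈ N` for `x ∈ N` (a scalar multiple of a finite sum of translates, or `0`).
[cite: BernsteinZelevinsky1976, §2.3] -/
theorem avg_mem {V : Type*} [AddCommGroup V] [Module ℂ V] {ρ : Representation ℂ G V} (N : Subrepresentation ρ) (H : Subgroup G)
    {x : V} (hx : x ∈ N.toSubmodule) : avg ρ H x ∈ N.toSubmodule := by
  rw [avg_eq_stabIn]
  exact N.toSubmodule.smul_mem _
    (finsum_induction (fun x => x ∈ N.toSubmodule) N.toSubmodule.zero_mem (fun _ _ hx hy => N.toSubmodule.add_mem hx hy)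
      fun q => N.apply_mem_toSubmodule _ hx)

omit [TopologicalSpace G] [IsTopologicalGroup G] in
/-- **An inner-product preserving `ρ` is unitarizable** in the sense of ★ `Representation.IsUnitarizable` (the inner product is an invariant positive-definite
Hermitian sesquilinear form). [cite: BushnellHenniart2006, §11.1] -/
theorem isUnitarizable_of_inner_map_map (hU : ∀ (g : G) (x y : V), ⟪ρ g x, ρ g y⟫_ℂ = ⟪x, y⟫_ℂ) : ρ.IsUnitarizable :=
  ⟨innerₛₗ ℂ, ⟨fun x y => inner_conj_symm (𝕜 := ℂ) y x⟩, fun v hv => by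
    simpa [innerₛₗ_apply_apply] using (re_inner_self_pos (𝕜 := ℂ)).2 hv, fun g v w => by
    simpa [innerₛₗ_apply_apply] using hU g v w⟩

/-! ## §2 Admissible + invariant inner product ⇒ every sub-representation has an invariant orthogonal complement -/

/-- **`V = N + Nᗮ` for every sub-representation `N` of an ADMISSIBLE inner-product preserving `ρ`** (`G` with some compact open subgroup `K₀`): for
`v ∈ V` there are `u ∈ N` and `u′ ⟂ N` with `v = u + u′` — the orthogonal decomposition inside the finite-dimensional `V^{K′}`, `K′ = K₀ ∩ Stab(v)`,
exported to all of `N` by the averaging projector. [cite: BernsteinZelevinsky1976, §2.3] [cite: Bump1997, §4.2] -/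
theorem exists_mem_add_mem_orthogonal (hU : ∀ (g : G) (x y : V), ⟪ρ g x, ρ g y⟫_ℂ = ⟪x, y⟫_ℂ) (hadm : ρ.IsAdmissible)
    {K₀ : Subgroup G} (hK₀o : IsOpen (K₀ : Set G)) (hK₀c : IsCompact (K₀ : Set G)) (N : Subrepresentation ρ) (v : V) :
    ∃ u ∈ N.toSubmodule, ∃ u' ∈ N.toSubmoduleᗮ, v = u + u' := by
  -- the compact open subgroup `K′ = K₀ ∩ Stab(v)` and the finite-dimensional `V^{K′} ∋ v`
  set K' : Subgroup G := K₀ ⊓ ρ.stabilizerSubgroup v with hK'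
  have hK'o : IsOpen (K' : Set G) := by
    rw [hK', Subgroup.coe_inf]
    exact hK₀o.inter (hadm.isSmooth v)
  have hK'c : IsCompact (K' : Set G) :=
    hK₀c.of_isClosed_subset (Subgroup.isClosed_of_isOpen _ hK'o) (by rw [hK', Subgroup.coe_inf]; exact Set.inter_subset_left)
  set F : Submodule ℂ V := ρ.fixedPoints K' with hF
  haveI : FiniteDimensional ℂ F := hadm.finite_fixedPoints ⟨K', hK'o⟩ hK'c
  have hvF : v ∈ F := (ρ.mem_fixedPoints K' v).2 fun k hk => (ρ.mem_stabilizerSubgroup v k).1 hk.2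
  -- the finite-dimensional `M = N ∩ V^{K′}` and its orthogonal projection
  set M : Submodule ℂ V := N.toSubmodule ⊓ F with hM
  haveI : FiniteDimensional ℂ M := Submodule.finiteDimensional_inf_right _ _
  haveI : M.HasOrthogonalProjection := Submodule.HasOrthogonalProjection.ofCompleteSpace M
  refine ⟨M.starProjection v, (Submodule.mem_inf.1 (M.starProjection_apply_mem v)).1, v - M.starProjection v, ?_, by abel⟩
  rw [Submodule.mem_orthogonal]
  intro x hx
  -- `v - P_M v` is `K′`-fixed, so `⟪x, ·⟫ = ⟪e_{K′} x, ·⟫` with `e_{K′} x ∈ M ⟂ (v - P_M v)`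
  have hu'F : v - M.starProjection v ∈ F := F.sub_mem hvF (Submodule.mem_inf.1 (M.starProjection_apply_mem v)).2
  have hB : ∀ (g : G) (x y : V), innerₛₗ ℂ (ρ g x) (ρ g y) = innerₛₗ ℂ x y := fun g x y => by
    rw [innerₛₗ_apply_apply, innerₛₗ_apply_apply]; exact hU g x y
  have h := form_apply_avg_left (ρ := ρ) (innerₛₗ ℂ) hB hK'c (hadm.isSmooth x) hu'F
  rw [innerₛₗ_apply_apply, innerₛₗ_apply_apply] at h
  rw [← h]
  exact (Submodule.mem_orthogonal M _).1 (M.sub_starProjection_mem_orthogonal v) _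
    (Submodule.mem_inf.2 ⟨avg_mem N K' hx, avg_mem_fixedPoints hK'c (hadm.isSmooth x)⟩)

/-- **`N ⊔ Nᗮ = ⊤`** under the hypotheses of `exists_mem_add_mem_orthogonal`. [cite: BernsteinZelevinsky1976, §2.3] -/
theorem sup_orthogonal_eq_top (hU : ∀ (g : G) (x y : V), ⟪ρ g x, ρ g y⟫_ℂ = ⟪x, y⟫_ℂ) (hadm : ρ.IsAdmissible)
    {K₀ : Subgroup G} (hK₀o : IsOpen (K₀ : Set G)) (hK₀c : IsCompact (K₀ : Set G)) (N : Subrepresentation ρ) :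
    N.toSubmodule ⊔ N.toSubmoduleᗮ = ⊤ := by
  rw [eq_top_iff]
  intro v _
  obtain ⟨u, hu, u', hu', rfl⟩ := exists_mem_add_mem_orthogonal hU hadm hK₀o hK₀c N v
  exact Submodule.add_mem_sup hu hu'

/-- **`N` and `Nᗮ` are complementary** (`N ⊓ Nᗮ = ⊥` always, `N ⊔ Nᗮ = ⊤` by admissibility): admissible inner-product preserving smooth representations
are SEMISIMPLE. [cite: BernsteinZelevinsky1976, §2.3] [cite: Casselman1995, §2.1] -/
theorem isCompl_orthogonal (hU : ∀ (g : G) (x y : V), ⟪ρ g x, ρ g y⟫_ℂ = ⟪x, y⟫_ℂ) (hadm : ρ.IsAdmissible)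
    {K₀ : Subgroup G} (hK₀o : IsOpen (K₀ : Set G)) (hK₀c : IsCompact (K₀ : Set G)) (N : Subrepresentation ρ) :
    IsCompl N.toSubmodule N.toSubmoduleᗮ :=
  ⟨disjoint_iff.2 (Submodule.inf_orthogonal_eq_bot N.toSubmodule), codisjoint_iff.2 (sup_orthogonal_eq_top hU hadm hK₀o hK₀c N)⟩

/-! ## §3 The cyclic span of a spherical Hecke line is irreducible -/

omit [TopologicalSpace G] [IsTopologicalGroup G] in
/-- In a decomposition `e = u + u′` along `V = N ⊕ Nᗮ` of a `K`-FIXED vector `e`, the component `u ∈ N` is `K`-fixed (uniqueness of the decomposition,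
`Nᗮ` being stable). [cite: BernsteinZelevinsky1976, §2.3] -/
theorem mem_fixedPoints_of_add_eq (hU : ∀ (g : G) (x y : V), ⟪ρ g x, ρ g y⟫_ℂ = ⟪x, y⟫_ℂ) (N : Subrepresentation ρ) {K : Subgroup G}
    {e u u' : V} (heK : e ∈ ρ.fixedPoints K) (hu : u ∈ N.toSubmodule) (hu' : u' ∈ N.toSubmoduleᗮ) (he : e = u + u') :
    u ∈ ρ.fixedPoints K := by
  rw [Representation.mem_fixedPoints] at heK ⊢
  intro k hk
  have hke := heK k hk
  rw [he, map_add] at hke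
  have hdiff : ρ k u - u = u' - ρ k u' := by
    rw [sub_eq_sub_iff_add_eq_add, hke, add_comm]
  have h1 : ρ k u - u ∈ N.toSubmodule := N.toSubmodule.sub_mem (N.apply_mem_toSubmodule k hu) hu
  have h2 : ρ k u - u ∈ N.toSubmoduleᗮ := by
    rw [hdiff]
    exact Submodule.sub_mem _ hu' (apply_mem_orthogonal hU N k hu')
  have h0 : ρ k u - u ∈ N.toSubmodule ⊓ N.toSubmoduleᗮ := Submodule.mem_inf.2 ⟨h1, h2⟩
  rw [Submodule.inf_orthogonal_eq_bot, Submodule.mem_bot] at h0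
  exact sub_eq_zero.1 h0

omit [TopologicalSpace G] [IsTopologicalGroup G] [NormedAddCommGroup V] [InnerProductSpace ℂ V] in
/-- `(⊥ : Subrepresentation ρ).toSubmodule = ⊥` and `(⊤ : Subrepresentation ρ).toSubmodule = ⊤` (Mathlib's `BoundedOrder` instance, by `rfl`).
[cite: BushnellHenniart2006, §2] -/
theorem toSubmodule_bot_top {V : Type*} [AddCommGroup V] [Module ℂ V] (ρ : Representation ℂ G V) :
    (⊥ : Subrepresentation ρ).toSubmodule = ⊥ ∧ (⊤ : Subrepresentation ρ).toSubmodule = ⊤ := ⟨rfl, rfl⟩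

/-- **THE CYCLIC SPAN OF A SPHERICAL HECKE LINE IS IRREDUCIBLE.**  Let `ρ` be ADMISSIBLE and inner-product preserving on the pre-Hilbert space `V`
(`G` with a compact open subgroup), `e ≠ 0` a `K`-fixed vector whose translates SPAN `V` and such that `V^K ⊆ ℂ e` (for a Hecke eigenvector `e` this is
★ `exists_eq_smul_of_mem_span_of_heckeEigenvector`, Bump Prop. 4.2.3).  Then `ρ` is IRREDUCIBLE. [cite: Bump1997, §4.2 Prop. 4.2.3]
[cite: BernsteinZelevinsky1976, §2.3] [cite: Casselman1995, §2.1] -/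
theorem isIrreducible_of_cyclic_spherical_line (hU : ∀ (g : G) (x y : V), ⟪ρ g x, ρ g y⟫_ℂ = ⟪x, y⟫_ℂ) (hadm : ρ.IsAdmissible)
    {K₀ : Subgroup G} (hK₀o : IsOpen (K₀ : Set G)) (hK₀c : IsCompact (K₀ : Set G)) {K : Subgroup G} {e : V} (he0 : e ≠ 0)
    (heK : e ∈ ρ.fixedPoints K) (hcyc : Submodule.span ℂ (Set.range fun g : G => ρ g e) = ⊤)
    (hline : ∀ z ∈ ρ.fixedPoints K, ∃ c : ℂ, z = c • e) : ρ.IsIrreducible := by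
  haveI : Nontrivial (Subrepresentation ρ) := ⟨⟨⊥, ⊤, fun h => he0 ?_⟩⟩
  swap
  · have h' := congrArg Subrepresentation.toSubmodule h
    rw [(toSubmodule_bot_top ρ).1, (toSubmodule_bot_top ρ).2] at h'
    have : e ∈ (⊥ : Submodule ℂ V) := h' ▸ Submodule.mem_top
    exact (Submodule.mem_bot ℂ).1 this
  refine { eq_bot_or_eq_top := fun N => ?_ }
  obtain ⟨u, hu, u', hu', he⟩ := exists_mem_add_mem_orthogonal hU hadm hK₀o hK₀c N e
  have huK : u ∈ ρ.fixedPoints K := mem_fixedPoints_of_add_eq hU N heK hu hu' he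
  obtain ⟨α, hα⟩ := hline u huK
  by_cases hα0 : α = 0
  · -- `u = 0`: `e ⟂ N`, so every translate is `⟂ N` and `N ≤ N ⊓ Nᗮ = ⊥`
    left
    have heN : e ∈ N.toSubmoduleᗮ := by
      rw [hα, hα0, zero_smul, zero_add] at he
      rwa [he]
    have hle : (⊤ : Submodule ℂ V) ≤ N.toSubmoduleᗮ := by
      rw [← hcyc, Submodule.span_le]
      rintro _ ⟨g, rfl⟩
      exact apply_mem_orthogonal hU N g heN
    apply Subrepresentation.toSubmodule_injective
    rw [(toSubmodule_bot_top ρ).1, eq_bot_iff]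
    intro x hx
    have hx' : x ∈ N.toSubmodule ⊓ N.toSubmoduleᗮ := Submodule.mem_inf.2 ⟨hx, hle Submodule.mem_top⟩
    rwa [Submodule.inf_orthogonal_eq_bot] at hx'
  · -- `u ≠ 0`: `e = α⁻¹ u ∈ N`, so every translate is in `N` and `N = ⊤`
    right
    have heN : e ∈ N.toSubmodule := by
      have : e = α⁻¹ • u := by rw [hα, smul_smul, inv_mul_cancel₀ hα0, one_smul]
      rw [this]
      exact N.toSubmodule.smul_mem _ hu
    apply Subrepresentation.toSubmodule_injective
    rw [(toSubmodule_bot_top ρ).2, eq_top_iff, ← hcyc, Submodule.span_le]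
    rintro _ ⟨g, rfl⟩
    exact N.apply_mem_toSubmodule g heN

end Summit.HodgeConjecture.HodgeConjecture.Cruxes.H413.F0P3AdmissibleUnitaryComplement

end
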